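import Mathlib
import Literature.Probability.LatticeModels.TorusFourier
import Literature.Probability.LatticeModels.CycleResolvent
import Literature.Probability.LatticeModels.CycleMomentumEstimates
import HarnessLib

/-!
# The lattice Maxwell kernel on the four-torus, I: transverse reduction and pointwise bounds

Topic `Probability/LatticeModels`. Object: the axis kernel sum
`H_L(μ, ν; n) = L⁻⁴ ∑_{k ∈ (ℤ/Lℤ)⁴, k ≠ 0} (1 - cos p_{k,μ}) cos(n p_{k,ν}) / ε(p_k)`,
`p_k = 2πk/L` (`latticeMomentum`), `ε(p) = ∑ᵢ (1 - cos pᵢ)` (`dispersion`), `μ ≠ ν` — the `μ`-part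
`k̂_μ²/k̂²` of the Fourier multiplier `(k̂_μ² + k̂_κ²)/k̂²` of the tree-level plaquette–plaquette
correlation `⟨F_{μκ}(0)F_{μκ}(n e_ν)⟩` (`ν ∉ {μ, κ}`) of four-dimensional lattice Maxwell theory,
equivalently the second lattice difference `-∂_μ² G̃_L(n e_ν)` of the zero-mode-free torus Green
function (`MaxwellKernelBand.lean`). PROVED here:

* `sum_erase_zero_eq_sum_transverse` — **transverse reduction**: summing first over the momentum
  component along the axis `ν` writes `L⁴ H_L` as `∑_{k' ∈ (ℤ/Lℤ)³} (1 - cos p_{k',μ'}) R(k')`,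
  `R(k') = ∑_j cos(2πjn/L)/(1 + ε'(k') - cos(2πj/L))` the cycle resolvent with mass parameter
  `a = 1 + ε'(k')`, `ε'` the three-dimensional transverse dispersion — which is POSITIVE and
  explicit (`sum_cos_div_sub_cos_cycle`);
* `maxwellKernel_upper_core`, `maxwellKernel_lower_core` — the real-variable cores of the two
  bounds (`λ^L ≤ 1/5`, `ε'/√(a²-1) ≤ X`, `λ ≤ e^{-X/24}`; resp. `n√(a²-1) ≤ 2`, `λⁿ ≥ e^{-3}` in
  the infrared box), `X = ∑ᵢ √(1 - cos p_{k',i})`;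
* `transverse_term_nonneg_le` — every transverse summand is `≥ 0` and `≤ (5/2) L X e^{-nX/24}`;
* `transverse_term_ge` — in the infrared box `k'ᵢ ∈ [1, M]`, `8nM ≤ L`, the summand is
  `≥ 4e^{-3} n (k'_{μ'})² / L`.

The estimates are elementary lattice perturbation theory (cf. Montvay–Münster, *Quantum Fields on
a Lattice*, §3.2 for the lattice photon propagator); no single source is followed, and constants
are not optimised. Deliberately NOT here: general dimension `d` (the decay `n^{-d}`), the
summation over `k'` (file II).
-/

noncomputable section

open Finset Real

namespace Literature.Probability.LatticeModels

/-- **Arithmetic core of the upper bound.** In terms of the transverse dispersion `ε'`, the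
quantities `s = √(a² - 1)` (`a = 1 + ε'`), the mass parameter `λ ∈ (0,1)` with `λ ≤ 1/(1+s)`, and
`X = ∑ᵢ √(1 - cos p'ᵢ)` (so `ε' ≤ X² ≤ 3ε'`, `X ≤ 6`): if `ε' ≥ 8/L²` and `2n ≤ L` then
`ε' s⁻¹ (λⁿ + λ^{L-n})/(1 - λ^L) ≤ (5/2) X e^{-nX/24}` (`λ^L ≤ 1/5`, `ε'/s ≤ X`,
`λ ≤ 1/(1 + X/3) ≤ e^{-X/24}`). [folklore] -/
theorem maxwellKernel_upper_core {ε' X s lam : ℝ} {n L : ℕ} (hL : L ≠ 0) (hn : 2 * n ≤ L)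
    (hε'8 : 8 / (L : ℝ) ^ 2 ≤ ε') (hε'0 : 0 < ε') (hs2 : s ^ 2 = ε' * (2 + ε')) (hs0 : 0 < s)
    (hl0 : 0 < lam) (hl1 : lam < 1) (hlam_le : lam ≤ 1 / (1 + s))
    (hX0 : 0 ≤ X) (hXsq : ε' ≤ X ^ 2) (hCS : X ^ 2 ≤ 3 * ε') (hX6 : X ≤ 6) :
    ε' * (1 / s * ((lam ^ n + lam ^ (L - n)) / (1 - lam ^ L))) ≤
      5 / 2 * (X * Real.exp (-(n / 24 * X))) := by
  have hL0 : (0 : ℝ) < L := by exact_mod_cast Nat.pos_of_ne_zero hL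
  have hlamL1 : lam ^ L < 1 := pow_lt_one₀ hl0.le hl1 hL
  -- `λ^L ≤ 1/5`
  have hs4 : 4 / (L : ℝ) ≤ s := by
    have h16 : (4 / (L : ℝ)) ^ 2 ≤ s ^ 2 := by
      rw [hs2]
      have e : (4 / (L : ℝ)) ^ 2 = 2 * (8 / (L : ℝ) ^ 2) := by ring
      rw [e]
      nlinarith only [hε'8, hε'0, sq_nonneg ε']
    exact (pow_le_pow_iff_left₀ (by positivity) hs0.le two_ne_zero).1 h16
  have hlamL : lam ^ L ≤ 1 / 5 := by
    have h1 : lam ≤ 1 / (1 + 4 / L) :=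
      hlam_le.trans (one_div_le_one_div_of_le (by positivity) (by linarith only [hs4]))
    have h2 : (5 : ℝ) ≤ (1 + 4 / (L : ℝ)) ^ L := by
      have h4 : (0 : ℝ) ≤ 4 / L := by positivity
      have h := one_add_mul_le_pow (a := 4 / (L : ℝ)) (by linarith only [h4]) L
      have e : (L : ℝ) * (4 / L) = 4 := by field_simp
      rw [e] at h
      linarith only [h]
    calc lam ^ L ≤ (1 / (1 + 4 / L)) ^ L := pow_le_pow_left₀ hl0.le h1 L
      _ = 1 / (1 + 4 / (L : ℝ)) ^ L := by rw [one_div_pow]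
      _ ≤ 1 / 5 := one_div_le_one_div_of_le (by norm_num) h2
  have hfrac : (lam ^ n + lam ^ (L - n)) / (1 - lam ^ L) ≤ 5 / 2 * lam ^ n := by
    rw [div_le_iff₀ (by linarith only [hlamL1])]
    have h1 : lam ^ (L - n) ≤ lam ^ n := pow_le_pow_of_le_one hl0.le hl1.le (by omega)
    nlinarith only [h1, hlamL, pow_nonneg hl0.le n, pow_nonneg hl0.le L]
  -- `ε'/s ≤ X`
  have hεs : ε' / s ≤ X := by
    have hsq : (ε' / s) ^ 2 ≤ X ^ 2 := by
      rw [div_pow, hs2]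
      calc ε' ^ 2 / (ε' * (2 + ε')) = ε' / (2 + ε') := by
            rw [sq, mul_div_mul_left _ _ hε'0.ne']
        _ ≤ ε' := div_le_self hε'0.le (by linarith only [hε'0])
        _ ≤ X ^ 2 := hXsq
    exact (pow_le_pow_iff_left₀ (by positivity) hX0 two_ne_zero).1 hsq
  -- `λ ≤ exp(-X/24)`
  have hXs : X / 3 ≤ s := by
    have hsq : (X / 3) ^ 2 ≤ s ^ 2 := by
      rw [hs2]
      have h1 : X ^ 2 / 9 ≤ ε' / 3 := by linarith only [hCS]
      have h2 : ε' / 3 ≤ ε' * (2 + ε') := by nlinarith only [sq_nonneg ε', hε'0]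
      rw [show (X / 3) ^ 2 = X ^ 2 / 9 by ring]
      exact h1.trans h2
    exact (pow_le_pow_iff_left₀ (by positivity) hs0.le two_ne_zero).1 hsq
  have hlam_exp : lam ≤ Real.exp (-(X / 24)) := by
    calc lam ≤ 1 / (1 + s) := hlam_le
      _ ≤ 1 / (1 + X / 3) := one_div_le_one_div_of_le (by positivity) (by linarith only [hXs])
      _ ≤ Real.exp (-(X / 3 / 8)) :=
          one_div_one_add_le_exp_neg (by positivity) (by linarith only [hX6])
      _ = Real.exp (-(X / 24)) := by ring_nf
  have hlamn : lam ^ n ≤ Real.exp (-(n / 24 * X)) := by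
    calc lam ^ n ≤ Real.exp (-(X / 24)) ^ n := pow_le_pow_left₀ hl0.le hlam_exp n
      _ = Real.exp (n * -(X / 24)) := (Real.exp_nat_mul _ _).symm
      _ = Real.exp (-(n / 24 * X)) := by ring_nf
  calc ε' * (1 / s * ((lam ^ n + lam ^ (L - n)) / (1 - lam ^ L)))
      ≤ ε' * (1 / s * (5 / 2 * lam ^ n)) := by gcongr
    _ = 5 / 2 * ((ε' / s) * lam ^ n) := by ring
    _ ≤ 5 / 2 * (X * Real.exp (-(n / 24 * X))) :=
        mul_le_mul_of_nonneg_left (mul_le_mul hεs hlamn (pow_nonneg hl0.le n) hX0) (by norm_num)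

/-- **Arithmetic core of the lower bound.** With `ε'`, `s`, `λ` as in `maxwellKernel_upper_core`,
`λ ≥ e^{-(ε' + s)}`, and the infrared smallness `n ε' ≤ 1`, `n² ε' ≤ 15/16`, `ε' ≤ 1`:
`(n/2) e^{-3} ≤ s⁻¹ (λⁿ + λ^{L-n})/(1 - λ^L)` (`n s ≤ 2`, `λⁿ ≥ e^{-3}`). [folklore] -/
theorem maxwellKernel_lower_core {ε' s lam : ℝ} {n L : ℕ} (hL : L ≠ 0)
    (hnε : (n : ℝ) * ε' ≤ 1) (hn2ε : (n : ℝ) ^ 2 * ε' ≤ 15 / 16) (hε'0 : 0 < ε') (hε'1 : ε' ≤ 1)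
    (hs2 : s ^ 2 = ε' * (2 + ε')) (hs0 : 0 < s)
    (hl0 : 0 < lam) (hl1 : lam < 1) (hlam_ge : Real.exp (-(ε' + s)) ≤ lam) :
    (n : ℝ) / 2 * Real.exp (-3) ≤ 1 / s * ((lam ^ n + lam ^ (L - n)) / (1 - lam ^ L)) := by
  have hlamL1 : lam ^ L < 1 := pow_lt_one₀ hl0.le hl1 hL
  -- `s n ≤ 2`
  have hsn : s * n ≤ 2 := by
    have hsq : (s * n) ^ 2 ≤ 2 ^ 2 := by
      rw [mul_pow, hs2]
      have h3 : (n : ℝ) ^ 2 * ε' * (2 + ε') ≤ 15 / 16 * 3 :=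
        mul_le_mul hn2ε (by linarith only [hε'1]) (by linarith only [hε'0]) (by norm_num)
      have e : ε' * (2 + ε') * (n : ℝ) ^ 2 = (n : ℝ) ^ 2 * ε' * (2 + ε') := by ring
      rw [e]
      linarith only [h3]
    exact (pow_le_pow_iff_left₀ (by positivity) (by norm_num) two_ne_zero).1 hsq
  have h1s : (n : ℝ) / 2 ≤ 1 / s := by
    rw [div_le_div_iff₀ two_pos hs0]
    linarith only [hsn]
  -- `λⁿ ≥ e^{-3}`
  have hlamn : Real.exp (-3) ≤ lam ^ n := by
    have e : (n : ℝ) * -(ε' + s) = -((n : ℝ) * ε') - s * n := by ring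
    calc Real.exp (-3) ≤ Real.exp (n * -(ε' + s)) :=
          Real.exp_le_exp.2 (by rw [e]; linarith only [hnε, hsn])
      _ = Real.exp (-(ε' + s)) ^ n := Real.exp_nat_mul _ _
      _ ≤ lam ^ n := pow_le_pow_left₀ (Real.exp_nonneg _) hlam_ge n
  have hfrac : lam ^ n ≤ (lam ^ n + lam ^ (L - n)) / (1 - lam ^ L) := by
    rw [le_div_iff₀ (by linarith only [hlamL1])]
    nlinarith only [pow_nonneg hl0.le (L - n), pow_nonneg hl0.le L, pow_nonneg hl0.le n]
  exact mul_le_mul h1s (hlamn.trans hfrac) (by positivity) (by positivity)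

section Transverse

variable {L : ℕ} [NeZero L]

/-- **Transverse reduction of the axis kernel sum.** Summing first over the momentum component
`k_ν` along the axis turns the four-dimensional sum into a three-dimensional sum of cycle
resolvents with mass parameter `a = 1 + ε'(k')`, `ε'` the transverse dispersion:
`∑_{k ≠ 0} (1 - cos p_{k,μ}) cos(n p_{k,ν}) / ε(p_k)
  = ∑_{k' ∈ (ℤ/Lℤ)³} (1 - cos p_{k',μ'}) ∑_{j ∈ ℤ/Lℤ} cos(2πjn/L) / (1 + ε'(k') - cos(2πj/L))`
(`μ = ν.succAbove μ'`; the `k = 0` term vanishes). [folklore] -/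
theorem sum_erase_zero_eq_sum_transverse (ν : Fin 4) (μ' : Fin 3) (n : ℕ) :
    ∑ k ∈ (univ : Finset (TorusSite 4 L)).erase 0,
        (1 - Real.cos (latticeMomentum L k (ν.succAbove μ'))) *
          Real.cos (latticeMomentum L k ν * n) / dispersion (latticeMomentum L k) =
      ∑ k' : TorusSite 3 L, (1 - Real.cos (latticeMomentum L k' μ')) *
        ∑ j : ZMod L, Real.cos (2 * π * (j.val : ℝ) / L * n) /
          ((1 + dispersion (latticeMomentum L k')) - Real.cos (2 * π * (j.val : ℝ) / L)) := by
  rw [Finset.sum_erase _ (by simp [latticeMomentum])]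
  rw [← Equiv.sum_comp (Fin.insertNthEquiv (fun _ => ZMod L) ν), Fintype.sum_prod_type,
    Finset.sum_comm]
  refine Finset.sum_congr rfl fun k' _ => ?_
  rw [Finset.mul_sum]
  refine Finset.sum_congr rfl fun j _ => ?_
  have h1 : latticeMomentum L ((Fin.insertNthEquiv (fun _ => ZMod L) ν) (j, k')) (ν.succAbove μ') =
      latticeMomentum L k' μ' := by
    simp [latticeMomentum]
  have h2 : latticeMomentum L ((Fin.insertNthEquiv (fun _ => ZMod L) ν) (j, k')) ν =
      2 * π * (j.val : ℝ) / L := by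
    simp [latticeMomentum]
  have h3 : dispersion (latticeMomentum L ((Fin.insertNthEquiv (fun _ => ZMod L) ν) (j, k'))) =
      (1 - Real.cos (2 * π * (j.val : ℝ) / L)) + dispersion (latticeMomentum L k') := by
    unfold dispersion
    rw [Fin.sum_univ_succAbove _ ν]
    congr 1
    · simp [latticeMomentum]
    · refine Finset.sum_congr rfl fun i _ => ?_
      simp [latticeMomentum]
  rw [h1, h2, h3, mul_div_assoc]
  congr 1
  ring

/-- **The transverse summand: sign and size.** For `k' ∈ (ℤ/Lℤ)³`, a transverse direction `μ'`
and `2n ≤ L`, the summand `T(k') = (1 - cos p_{k',μ'}) ∑_j cos(2πjn/L)/(1 + ε'(k') - cos(2πj/L))`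
of `sum_erase_zero_eq_sum_transverse` is nonnegative and bounded by
`(5/2) L X e^{-nX/24}`, `X = ∑ᵢ √(1 - cos p_{k',i})`. Proof: for `k'_{μ'} = 0` it vanishes;
otherwise `ε' ≥ 8/L²`, the inner sum is the cycle resolvent `L (λⁿ + λ^{L-n})/(√(a²-1)(1 - λ^L))`
(`sum_cos_div_sub_cos_cycle`) with `λ^L ≤ 1/5`, `ε'/√(a² - 1) ≤ X` and
`λ ≤ 1/(1 + X/3) ≤ e^{-X/24}`. [folklore] -/
theorem transverse_term_nonneg_le (k' : TorusSite 3 L) (μ' : Fin 3) {n : ℕ} (hn : 2 * n ≤ L) :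
    0 ≤ (1 - Real.cos (latticeMomentum L k' μ')) *
        ∑ j : ZMod L, Real.cos (2 * π * (j.val : ℝ) / L * n) /
          ((1 + dispersion (latticeMomentum L k')) - Real.cos (2 * π * (j.val : ℝ) / L)) ∧
    (1 - Real.cos (latticeMomentum L k' μ')) *
        ∑ j : ZMod L, Real.cos (2 * π * (j.val : ℝ) / L * n) /
          ((1 + dispersion (latticeMomentum L k')) - Real.cos (2 * π * (j.val : ℝ) / L)) ≤
      5 / 2 * L * ((∑ i, Real.sqrt (1 - Real.cos (latticeMomentum L k' i))) *
        Real.exp (-(n / 24 * ∑ i, Real.sqrt (1 - Real.cos (latticeMomentum L k' i))))) := by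
  set X := ∑ i, Real.sqrt (1 - Real.cos (latticeMomentum L k' i)) with hX
  have hX0 : 0 ≤ X := sum_nonneg fun i _ => Real.sqrt_nonneg _
  have hRHS : 0 ≤ 5 / 2 * L * (X * Real.exp (-(n / 24 * X))) := by positivity
  by_cases h0 : k' μ' = 0
  · have : Real.cos (latticeMomentum L k' μ') = 1 := by simp [latticeMomentum, h0]
    rw [this, sub_self, zero_mul]
    exact ⟨le_rfl, hRHS⟩
  -- the massive case
  have hL0 : (0 : ℝ) < L := by exact_mod_cast Nat.pos_of_ne_zero (NeZero.ne L)
  set ε' := dispersion (latticeMomentum L k') with hε'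
  have hcos0 : 0 ≤ 1 - Real.cos (latticeMomentum L k' μ') := sub_nonneg.2 (Real.cos_le_one _)
  have hq8 : 8 / (L : ℝ) ^ 2 ≤ 1 - Real.cos (latticeMomentum L k' μ') :=
    eight_div_sq_le_one_sub_cos h0
  have hqε : 1 - Real.cos (latticeMomentum L k' μ') ≤ ε' := by
    rw [hε', dispersion]
    exact Finset.single_le_sum (f := fun i => 1 - Real.cos (latticeMomentum L k' i))
      (fun i _ => sub_nonneg.2 (Real.cos_le_one _)) (mem_univ μ')
  have hε'8 : 8 / (L : ℝ) ^ 2 ≤ ε' := hq8.trans hqε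
  have hε'0 : 0 < ε' := lt_of_lt_of_le (by positivity) hε'8
  have hε'2 : 0 < 2 + ε' := by linarith only [hε'0]
  have ha : 1 < 1 + ε' := by linarith only [hε'0]
  obtain ⟨hl0, hl1, hla, hls⟩ := massParam_spec ha
  have hlam_le := massParam_le ha
  set s := Real.sqrt ((1 + ε') ^ 2 - 1) with hs
  set lam := 1 + ε' - s with hlam
  have hsq' : (1 + ε') ^ 2 - 1 = ε' * (2 + ε') := by ring
  have hs2 : s ^ 2 = ε' * (2 + ε') := by
    rw [hs, Real.sq_sqrt (by rw [hsq']; exact (mul_pos hε'0 hε'2).le)]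
    exact hsq'
  have hs0 : 0 < s := by
    rw [hs, hsq']
    exact Real.sqrt_pos.2 (mul_pos hε'0 hε'2)
  -- the closed form of the inner sum
  have hS : ∑ j : ZMod L, Real.cos (2 * π * (j.val : ℝ) / L * n) /
      ((1 + ε') - Real.cos (2 * π * (j.val : ℝ) / L)) =
      L * (2 * lam * (lam ^ n + lam ^ (L - n)) / ((1 - lam ^ 2) * (1 - lam ^ L))) := by
    have h := sum_cos_div_sub_cos_cycle hl0 hl1 (L := L) (n := n) (by omega)
    rwa [hla] at h
  have hlamL1 : lam ^ L < 1 := pow_lt_one₀ hl0.le hl1 (NeZero.ne L)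
  have hform : 2 * lam * (lam ^ n + lam ^ (L - n)) / ((1 - lam ^ 2) * (1 - lam ^ L)) =
      1 / s * ((lam ^ n + lam ^ (L - n)) / (1 - lam ^ L)) := by
    rw [← hls, div_mul_div_comm]
  rw [hS, hform]
  have hfrac0 : 0 ≤ (lam ^ n + lam ^ (L - n)) / (1 - lam ^ L) :=
    div_nonneg (add_nonneg (pow_nonneg hl0.le _) (pow_nonneg hl0.le _))
      (by linarith only [hlamL1])
  have hinner0 : 0 ≤ (L : ℝ) * (1 / s * ((lam ^ n + lam ^ (L - n)) / (1 - lam ^ L))) :=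
    mul_nonneg hL0.le (mul_nonneg (one_div_pos.2 hs0).le hfrac0)
  refine ⟨mul_nonneg hcos0 hinner0, ?_⟩
  -- the inputs of the arithmetic core
  have hsumsq : ∑ i, Real.sqrt (1 - Real.cos (latticeMomentum L k' i)) ^ 2 = ε' := by
    rw [hε', dispersion]
    refine sum_congr rfl fun i _ => ?_
    rw [Real.sq_sqrt (sub_nonneg.2 (Real.cos_le_one _))]
  have hXsq : ε' ≤ X ^ 2 := by
    rw [← hsumsq]
    exact sum_sq_le_sq_sum _ (fun i _ => Real.sqrt_nonneg _)
  have hCS : X ^ 2 ≤ 3 * ε' := by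
    have h := sq_sum_le_card_mul_sum_sq (s := (univ : Finset (Fin 3)))
      (f := fun i => Real.sqrt (1 - Real.cos (latticeMomentum L k' i)))
    simp only [card_univ, Fintype.card_fin, Nat.cast_ofNat] at h
    rw [hsumsq] at h
    exact h
  have hX6 : X ≤ 6 := by
    calc X ≤ ∑ _i : Fin 3, (2 : ℝ) := by
          refine sum_le_sum fun i _ => ?_
          rw [Real.sqrt_le_left (by norm_num)]
          linarith only [Real.neg_one_le_cos (latticeMomentum L k' i)]
      _ = 6 := by simp; norm_num
  have hcore := maxwellKernel_upper_core (NeZero.ne L) hn hε'8 hε'0 hs2 hs0 hl0 hl1 hlam_le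
    hX0 hXsq hCS hX6
  calc (1 - Real.cos (latticeMomentum L k' μ')) *
        (L * (1 / s * ((lam ^ n + lam ^ (L - n)) / (1 - lam ^ L))))
      ≤ ε' * (L * (1 / s * ((lam ^ n + lam ^ (L - n)) / (1 - lam ^ L)))) :=
        mul_le_mul_of_nonneg_right hqε hinner0
    _ = L * (ε' * (1 / s * ((lam ^ n + lam ^ (L - n)) / (1 - lam ^ L)))) := by ring
    _ ≤ L * (5 / 2 * (X * Real.exp (-(n / 24 * X)))) := mul_le_mul_of_nonneg_left hcore hL0.le
    _ = 5 / 2 * L * (X * Real.exp (-(n / 24 * X))) := by ring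

/-- **The transverse summand in the infrared box.** If `8 n M ≤ L`, `1 ≤ n`, and all components of
`k'` have representatives in `[1, M]`, then
`4 e^{-3} n (k'_{μ'}.val)² / L ≤ T(k')`: here `ε' ≤ 3π²/(32n²)`, so `n √(a² - 1) ≤ 2`, `λⁿ ≥ e^{-3}`
(`exp_neg_le_massParam`), and `1 - cos p_{k',μ'} ≥ 8 (k'_{μ'}.val)²/L²`. [folklore] -/
theorem transverse_term_ge (k' : TorusSite 3 L) (μ' : Fin 3) {n M : ℕ} (hn : 1 ≤ n)
    (hM : 8 * n * M ≤ L) (hk : ∀ i, 1 ≤ (k' i).val ∧ (k' i).val ≤ M) :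
    4 * Real.exp (-3) * n * ((k' μ').val : ℝ) ^ 2 / L ≤
      (1 - Real.cos (latticeMomentum L k' μ')) *
        ∑ j : ZMod L, Real.cos (2 * π * (j.val : ℝ) / L * n) /
          ((1 + dispersion (latticeMomentum L k')) - Real.cos (2 * π * (j.val : ℝ) / L)) := by
  have hL0 : (0 : ℝ) < L := by exact_mod_cast Nat.pos_of_ne_zero (NeZero.ne L)
  have hLne : (L : ℝ) ≠ 0 := hL0.ne'
  have hn0 : (0 : ℝ) < n := by exact_mod_cast hn
  have hnne : (n : ℝ) ≠ 0 := hn0.ne'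
  have hn1 : (1 : ℝ) ≤ n := by exact_mod_cast hn
  have hM1 : 1 ≤ M := (hk μ').1.trans (hk μ').2
  have hnL : n ≤ L := le_trans (by nlinarith only [hM1, hn]) hM
  -- the momenta are small
  have hq : ∀ i, 0 ≤ latticeMomentum L k' i ∧ latticeMomentum L k' i ≤ π / (4 * n) := by
    intro i
    obtain ⟨-, h2⟩ := hk i
    simp only [latticeMomentum]
    refine ⟨by positivity, ?_⟩
    rw [div_le_div_iff₀ hL0 (by positivity)]
    have : (8 * n * (k' i).val : ℝ) ≤ L := by
      exact_mod_cast le_trans (Nat.mul_le_mul_left _ h2) hM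
    nlinarith only [this, Real.pi_pos]
  set ε' := dispersion (latticeMomentum L k') with hε'
  have hε'le : ε' ≤ 3 * ((π / (4 * n)) ^ 2 / 2) := by
    rw [hε', dispersion]
    calc ∑ i, (1 - Real.cos (latticeMomentum L k' i)) ≤ ∑ _i : Fin 3, (π / (4 * n)) ^ 2 / 2 := by
          refine sum_le_sum fun i _ => ?_
          have h1 := Real.one_sub_sq_div_two_le_cos (x := latticeMomentum L k' i)
          have h2 : latticeMomentum L k' i ^ 2 ≤ (π / (4 * n)) ^ 2 :=
            pow_le_pow_left₀ (hq i).1 (hq i).2 2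
          linarith only [h1, h2]
      _ = 3 * ((π / (4 * n)) ^ 2 / 2) := by simp
  have hπ : π ^ 2 < 10 := by nlinarith only [Real.pi_lt_d2, Real.pi_pos]
  have hn2ε : (n : ℝ) ^ 2 * ε' ≤ 15 / 16 := by
    have e : (n : ℝ) ^ 2 * (3 * ((π / (4 * n)) ^ 2 / 2)) = 3 * π ^ 2 / 32 := by
      field_simp
      ring
    have h := mul_le_mul_of_nonneg_left hε'le (sq_nonneg (n : ℝ))
    rw [e] at h
    linarith only [h, hπ]
  have hε'0' : 0 ≤ ε' := dispersion_nonneg _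
  have hn2 : (1 : ℝ) ≤ (n : ℝ) ^ 2 := by nlinarith only [hn1]
  have hε'1 : ε' ≤ 1 := by nlinarith only [hn2ε, hn2, hε'0']
  have hnε : (n : ℝ) * ε' ≤ 1 := by nlinarith only [hn2ε, hn1, hε'0']
  -- positivity of `ε'`
  have hv1 : 1 ≤ (k' μ').val := (hk μ').1
  have hq8 : 8 * ((k' μ').val : ℝ) ^ 2 / (L : ℝ) ^ 2 ≤ 1 - Real.cos (latticeMomentum L k' μ') := by
    have h2v : 2 * (k' μ').val ≤ L :=
      le_trans (Nat.mul_le_mul (by omega : 2 ≤ 8 * n) (hk μ').2) hM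
    exact eight_mul_sq_div_sq_le_one_sub_cos (L := L) h2v
  have hqε : 1 - Real.cos (latticeMomentum L k' μ') ≤ ε' := by
    rw [hε', dispersion]
    exact Finset.single_le_sum (f := fun i => 1 - Real.cos (latticeMomentum L k' i))
      (fun i _ => sub_nonneg.2 (Real.cos_le_one _)) (mem_univ μ')
  have hcos0 : 0 ≤ 1 - Real.cos (latticeMomentum L k' μ') := sub_nonneg.2 (Real.cos_le_one _)
  have hv1' : (1 : ℝ) ≤ (k' μ').val := by exact_mod_cast hv1
  have hε'0 : 0 < ε' := by
    refine lt_of_lt_of_le ?_ (hq8.trans hqε)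
    apply div_pos _ (by positivity)
    nlinarith only [hv1']
  have hε'2 : 0 < 2 + ε' := by linarith only [hε'0]
  have ha : 1 < 1 + ε' := by linarith only [hε'0]
  obtain ⟨hl0, hl1, hla, hls⟩ := massParam_spec ha
  have hlam_ge := exp_neg_le_massParam ha
  set s := Real.sqrt ((1 + ε') ^ 2 - 1) with hs
  set lam := 1 + ε' - s with hlam
  have hsq' : (1 + ε') ^ 2 - 1 = ε' * (2 + ε') := by ring
  have hs2 : s ^ 2 = ε' * (2 + ε') := by
    rw [hs, Real.sq_sqrt (by rw [hsq']; exact (mul_pos hε'0 hε'2).le)]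
    exact hsq'
  have hs0 : 0 < s := by
    rw [hs, hsq']
    exact Real.sqrt_pos.2 (mul_pos hε'0 hε'2)
  have hS : ∑ j : ZMod L, Real.cos (2 * π * (j.val : ℝ) / L * n) /
      ((1 + ε') - Real.cos (2 * π * (j.val : ℝ) / L)) =
      L * (2 * lam * (lam ^ n + lam ^ (L - n)) / ((1 - lam ^ 2) * (1 - lam ^ L))) := by
    have h := sum_cos_div_sub_cos_cycle hl0 hl1 (L := L) (n := n) hnL
    rwa [hla] at h
  have hform : 2 * lam * (lam ^ n + lam ^ (L - n)) / ((1 - lam ^ 2) * (1 - lam ^ L)) =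
      1 / s * ((lam ^ n + lam ^ (L - n)) / (1 - lam ^ L)) := by
    rw [← hls, div_mul_div_comm]
  rw [hS, hform]
  have ha1 : 1 + ε' - 1 = ε' := by ring
  rw [ha1] at hlam_ge
  have hcore := maxwellKernel_lower_core (L := L) (n := n) (NeZero.ne L) hnε hn2ε hε'0 hε'1 hs2
    hs0 hl0 hl1 hlam_ge
  calc 4 * Real.exp (-3) * n * ((k' μ').val : ℝ) ^ 2 / L =
        (8 * ((k' μ').val : ℝ) ^ 2 / (L : ℝ) ^ 2) * (L * ((n / 2) * Real.exp (-3))) := by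
          field_simp
          ring
    _ ≤ (1 - Real.cos (latticeMomentum L k' μ')) *
          (L * (1 / s * ((lam ^ n + lam ^ (L - n)) / (1 - lam ^ L)))) :=
          mul_le_mul hq8 (mul_le_mul_of_nonneg_left hcore hL0.le) (by positivity) hcos0

end Transverse

end Literature.Probability.LatticeModels

end
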